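import Literature.NumberTheory.Rogawski1990.CurveThetaHodgeTypeNecessity
import HarnessLib

/-!
# Crux `HLiu418` — NEGATIVE EDGE (R2) of ruling «LD-R1»: letter #74 AS TYPED, `Rogawski1990.curveThetaHodgeTypeNecessity_hol`, is FALSE
# modulo the cone-flip transport and one honest antiholomorphic theta occurrence

Cell hodgecm-mathlib (D-0151), FLOOR 0; crux item `HLiu418` = stmt-HodgeConjecture-24832; socket `Cruxes/HLiu418/Lines/F0_AlbCm.lean` ED. 10
`stub_S1b_facts : Rogawski1990.curveThetaHodgeTypeNecessity_hol` = stmt-HodgeConjecture-27458.  Seat LD2-p02 (g0), order (R2) of the LEAD ruling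
«LD-R1» (F0P6-plan (g3) 2026-09-02T03:05:24Z; class MISSTATED, LD-ref1 (g0) CONCUR 02:53:24Z; repair = re-letter #74R ★ `curveThetaHodgeTypeNecessity_hol_pos`,
p848618).  `--supports stmt-HodgeConjecture-27458 --negative-modulo ConeFlipTransport₂`.  Two closed `Prop`s (the inputs; Summit-side construction items, deliberately WITHOUT cite tags so that the gate does not
relocate them to `Literature/` — they are not letters) + one theorem; no instance, no notation, no `sorry`.

THE DEFECT.  #74 binds the rational frame as `(t : L) (ht : t ≠ 0) (g) (hg : formCongr c g (t • H) = diag dV)` WITHOUT the consumer's orientation binders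
`0 < (ι t).re`, `(ι t).im = 0` (`S1BettiShape`, `F0_AlbCm.lean` :128), while its Hodge-type clause `P.IsHolCotangentAt₂ … (cmPlace L ι) 𝔣`,
`𝔣 : ConeFrame L H (cmPlace L ι)`, is read on the NEGATIVE CONE OF `H` — whose sign flips under `(H, t) ↦ (−H, −t)`, a substitution that fixes `t • H` and
hence EVERY other binder of the letter (`hg`, the signature and definiteness clauses, `finAdelicCongr … g _ _` as a map of matrices, `rhoVAtLine …`, the
admissibility clause, the conclusion).  Liu's hermitian space is `V = t • H`; for `ι t < 0` «holomorphic for `(H, 𝔣)`» is «ANTIholomorphic for `V`».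

THE TWO INPUTS (closed `Prop`s, both TRUE in nature, neither constructible in the tree today — the gate files them as construction items):
* `ConeFlipTransport₂` — THE CONE-FLIP TRANSPORT (in-house; pure bookkeeping along `U(−H) = U(H)`): every `(0,1)`-type (`IsAntiholCotangentAt₂` for a cone
  frame of `H`) discrete `P` of `U(H)` with a θ-type finite component `σ ↪ ω(λ, ε_a, χ)_f ∘ (finAdelicCongr … g ht hg)⁻¹` yields, on the datum of `−H` with
  the frame `(g, −t)` (`formCongr c g ((−t) • (−H)) = diag dV`), a `(1,0)`-type (`IsHolCotangentAt₂` for a cone frame of `−H`) discrete `P♭` with a θ-type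
  finite component into the SAME carrier `ω(λ, ε_a, χ)_f`.  In nature `P♭ = P` (same functions on the same group `U(−H)(𝔸) = U(H)(𝔸)`, ★
  `UnitaryGroup.adelicGroupData_cm_smul`; the flipped frame `𝔣♭ = (t₀, v₀)` and the archimedean core «the conjugate of an `IsConeHol 𝔣` slice is an
  `IsConeHol 𝔣♭` slice for `−H`» are ★ `F0LD2ConeFlip.exists_isConeHol_flip`, p848320); what the tree lacks is the transport of the adelic clauses
  (L), (Kc), (Sm) of ★ `holCotForms₂`, of `ContainsFun` and of `HasFinComponent` across the propositional (not definitional) identification of the two data.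
* `AntiholThetaOccurrence₂` — ONE HONEST ANTIHOLOMORPHIC THETA OCCURRENCE in the POSITIVE orientation: some CM field `L` (`4 ≤ [L:ℚ]`), `ι`, `H` of
  signature `(1,1)` at `ι` and definite elsewhere in a frame `(g, t)` with `0 < ι t` real, a label `λ` (conjugate symplectic, weight one) whose CM type
  OMITS `e♮ = (cmPlace L ι).1.embedding`, a line `⟨a⟩` and `χ ∈ Chi` with `ε_a` `λ`-admissible, and a discrete `P` of `U(H)` of Hodge type `(0,1)` at `ι`
  whose finite component embeds in `ω(λ, ε_a, χ)_f` — [Liu2021, Rem. D.5] «`m_cusp(π^{(0,1)}_∞ ⊗ ω(μ,ε,χ)) = 1` iff some `e` with collection `ε` is negative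
  on `Φ_μ ∖ {τ′₁}` and POSITIVE at `τ′₁`» for the endoscopic cohomological `π^∞ ≅ ω(μ, ε, χ)` of [Prop. D.4 (1)] (with `e♮ ∉ Φ_λ`, admissibility for
  `Φ_λ ∋ ē♮` is exactly that sign pattern), such `π^∞` existing on every compact unitary Shimura curve by the non-vanishing of theta lifts from `U(1)`
  [GelbartRogawski1991, §3], [Rogawski1990, §13.3].

THE THEOREM `curveThetaHodgeTypeNecessity_hol_false_of_coneFlipTransport₂ : ConeFlipTransport₂ → AntiholThetaOccurrence₂ → ¬ curveThetaHodgeTypeNecessity_hol`: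
flip the honest `(0,1)` occurrence to a `(1,0)` occurrence on the datum of `−H` in the frame `(g, −t)` (orientation now NEGATIVE, which #74 does not
exclude) and apply #74 there: it returns `e♮ ∈ Φ_λ`, contradicting `e♮ ∉ Φ_λ`.  The re-letter #74R refuses the flipped instance by `hτt : 0 < (ι t).re`.

HONEST LABEL: HC_CM is proved only modulo the 7 printed citations (2 remaining: hLiu418 = stmt-HodgeConjecture-24832, h413 = stmt-HodgeConjecture-24833)
until rung 0 closes; this file is a NEGATIVE-modulo lemma on a withdrawn letter (count-neutral); it refutes nothing unconditionally and books nothing.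

## References
* [Liu2021] Y. Liu, Camb. J. Math. 9 (2021) = arXiv:2102.11518, App. D: Def. D.3, Prop. D.4 (1) and its proof (p. 130–131), Rem. D.5 (p. 131); Def. 4.12.
* [Rogawski1990] J. Rogawski, Ann. of Math. Stud. 123 (1990), §11.1–11.2, §13.3.
* [GelbartRogawski1991] S. Gelbart, J. Rogawski, Invent. Math. 105 (1991), §3.
* [BorelWallach2000] A. Borel, N. Wallach, 2nd ed. (2000), VII 2.10, 3.2, 3.6.
-/

set_option autoImplicit false
-- the mandated namespace has the single-problem summit's repeated segment (`HodgeConjecture.HodgeConjecture`)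
set_option linter.dupNamespace false

noncomputable section

open NumberField NumberField.InfinitePlace MeasureTheory IsDedekindDomain
open scoped Matrix ComplexOrder

namespace Summit.HodgeConjecture.HodgeConjecture.Cruxes.HLiu418.F0LD2CurveThetaConeFlipNegative

open Literature.NumberTheory.Automorphic Literature.NumberTheory.Automorphic.UnitaryGroup
open Literature.NumberTheory.Automorphic.UnitaryCurveForms
open Literature.NumberTheory.Automorphic.Liu2021 Literature.NumberTheory.Automorphic.Liu2021.Def411WeilCarriers
open Literature.NumberTheory.Automorphic.Liu2021.Def411WeilCarriersDoubling
open Literature.NumberTheory.GaloisRepresentations Literature.NumberTheory.Automorphic.IdeleClassGroup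
open Literature.AlgebraicGeometry.Liu2021 (IsAdmissibleElement)
open Literature.NumberTheory.GelbartRogawski1991 Literature.NumberTheory.GelbartRogawski1991.UnitaryDualPair
open Literature.RepresentationTheory.Liu2021 Literature.RepresentationTheory.HarrisKudlaSweet1996
open Literature.NumberTheory.Rogawski1990

/-! ## §1 The two inputs -/

/-- **`ConeFlipTransport₂` — the cone-flip transport `(H, t, 𝔣, (0,1)) ↦ (−H, −t, 𝔣♭, (1,0))` of the letter's data** (in-house construction item; TRUE in
nature: `U(−H) = U(H)` as groups, ★ `UnitaryGroup.adelicGroupData_cm_smul`, the SAME automorphic representation and finite component, the flipped cone frame and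
the conjugate slices ★ `F0LD2ConeFlip.exists_isConeHol_flip`; not yet constructible in the tree because the two adelic data are only PROPOSITIONALLY equal).
For every frame `(L, ι, H, dV, t, g, hg)`, cone frame `𝔣` of `H` at `ι`, automorphic measure, reindexing `e₁`, label `λ`, line `a`, `χ ∈ Chi`, irreducible smooth
`σ` with an injective intertwiner into `ω(λ, ε_a, χ)_f ∘ (finAdelicCongr … g ht hg)⁻¹` and discrete `P` of `U(H)` that is `(0,1)`-type at `ι` for `𝔣` with finite
component `σ`: for the frame `(g, −t)` of `−H` (any proofs `ht'`, `hg'`) there are a cone frame `𝔣'` of `−H` at `ι`, an automorphic measure `μ'`, an irreducible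
smooth `σ'` with an injective intertwiner into `ω(λ, ε_a, χ)_f ∘ (finAdelicCongr … g ht' hg')⁻¹`, and a discrete `P'` of `U(−H)` that is `(1,0)`-type at `ι` for `𝔣'`
with finite component `σ'`.  (In-house construction item, NOT a literature fact: references Borel–Wallach VII 2.10∕3.6 and Liu 2021 App. D l. 5357–5359
for the Hodge-type dictionary only.) -/
def ConeFlipTransport₂ : Prop :=
  ∀ (L : Type) [Field L] [NumberField L] [IsCMField L] (ι : L →+* ℂ) (H : Matrix (Fin 2) (Fin 2) L)
    (dV : Fin 2 → L) (hdV : ∀ i, IsCMField.complexConj L (dV i) = dV i) (hdV0 : ∀ i, dV i ≠ 0)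
    (t : L) (ht : t ≠ 0) (g : GL (Fin 2) L)
    (hg : formCongr ((IsCMField.complexConj L : L ≃ₐ[↥(maximalRealSubfield L)] L) : L →+* L) g (t • H) = Matrix.diagonal dV)
    (𝔣 : ConeFrame L H (cmPlace L ι))
    (μ : Measure (adelicGroupData (↥(maximalRealSubfield L)) L (IsCMField.complexConj L) 2 H).automorphicQuotient)
    [(adelicGroupData (↥(maximalRealSubfield L)) L (IsCMField.complexConj L) 2 H).IsAutomorphicMeasure μ]
    {n' : ℕ} (e₁ : Fin 2 × Fin 1 ≃ Fin n')
    (lam : Literature.NumberTheory.Automorphic.IdeleClassGroup L →ₜ* Circle) (hlam : IsConjugateSymplectic L lam)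
    (a : (↥(maximalRealSubfield L))ˣ) (χ : Chi (↥(maximalRealSubfield L)) L (IsCMField.complexConj L))
    (W : Type) [AddCommGroup W] [Module ℂ W]
    (σ : Representation ℂ (finAdelic (↥(maximalRealSubfield L)) L (IsCMField.complexConj L) 2 H) W),
    σ.IsIrreducible → σ.IsSmooth →
    ∀ j : σ.IntertwiningMap
        ((rhoVAtLine (↥(maximalRealSubfield L)) L (IsCMField.complexConj L) 2 e₁ (Matrix.diagonal dV)
            (complexConj_imagUnit L) (imagUnit_ne_zero L) (imagUnit_mul_self L) (realDiagonal_isSymm L dV hdV)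
            (isUnit_det_realDiagonal L dV hdV hdV0) (realDiagonal_map L dV hdV).symm
            (fun a => isCompatible_chiSplittingLine L e₁ dV hdV hdV0 (toHeckeCharacter L lam)
              (isUnitary_toHeckeCharacter L lam) ((isOscillatorChar_toHeckeCharacter_iff lam).mpr hlam)
              (TW (↥(maximalRealSubfield L)) a) (isSymm_TW (↥(maximalRealSubfield L)) a)
              (isUnit_det_TW (↥(maximalRealSubfield L)) a) (JW (↥(maximalRealSubfield L)) L a)
              (JW_eq (↥(maximalRealSubfield L)) L a)) a χ).comp
          (finAdelicCongr (↥(maximalRealSubfield L)) L (IsCMField.complexConj L) g ht hg).symm.toMonoidHom),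
      Function.Injective j →
    ∀ P : DiscreteAutomorphicRep (adelicGroupData (↥(maximalRealSubfield L)) L (IsCMField.complexConj L) 2 H) μ,
      P.IsAntiholCotangentAt₂ (IsCMField.complexConj_ne_one L) (UnitaryGroup.complexConj_smul_infinitePlace L) (cmPlace L ι) 𝔣 →
      P.HasFinComponent σ →
    ∀ (ht' : -t ≠ 0)
      (hg' : formCongr ((IsCMField.complexConj L : L ≃ₐ[↥(maximalRealSubfield L)] L) : L →+* L) g ((-t) • (-H)) = Matrix.diagonal dV),
    ∃ (𝔣' : ConeFrame L (-H) (cmPlace L ι))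
      (μ' : Measure (adelicGroupData (↥(maximalRealSubfield L)) L (IsCMField.complexConj L) 2 (-H)).automorphicQuotient)
      (_ : (adelicGroupData (↥(maximalRealSubfield L)) L (IsCMField.complexConj L) 2 (-H)).IsAutomorphicMeasure μ')
      (W' : Type) (_ : AddCommGroup W') (_ : Module ℂ W')
      (σ' : Representation ℂ (finAdelic (↥(maximalRealSubfield L)) L (IsCMField.complexConj L) 2 (-H)) W')
      (_ : σ'.IsIrreducible) (_ : σ'.IsSmooth)
      (j' : σ'.IntertwiningMap
        ((rhoVAtLine (↥(maximalRealSubfield L)) L (IsCMField.complexConj L) 2 e₁ (Matrix.diagonal dV)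
            (complexConj_imagUnit L) (imagUnit_ne_zero L) (imagUnit_mul_self L) (realDiagonal_isSymm L dV hdV)
            (isUnit_det_realDiagonal L dV hdV hdV0) (realDiagonal_map L dV hdV).symm
            (fun a => isCompatible_chiSplittingLine L e₁ dV hdV hdV0 (toHeckeCharacter L lam)
              (isUnitary_toHeckeCharacter L lam) ((isOscillatorChar_toHeckeCharacter_iff lam).mpr hlam)
              (TW (↥(maximalRealSubfield L)) a) (isSymm_TW (↥(maximalRealSubfield L)) a)
              (isUnit_det_TW (↥(maximalRealSubfield L)) a) (JW (↥(maximalRealSubfield L)) L a)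
              (JW_eq (↥(maximalRealSubfield L)) L a)) a χ).comp
          (finAdelicCongr (↥(maximalRealSubfield L)) L (IsCMField.complexConj L) g ht' hg').symm.toMonoidHom))
      (_ : Function.Injective j')
      (P' : DiscreteAutomorphicRep (adelicGroupData (↥(maximalRealSubfield L)) L (IsCMField.complexConj L) 2 (-H)) μ'),
      P'.IsHolCotangentAt₂ (IsCMField.complexConj_ne_one L) (UnitaryGroup.complexConj_smul_infinitePlace L) (cmPlace L ι) 𝔣' ∧
        P'.HasFinComponent σ'

/-- **`AntiholThetaOccurrence₂` — one honest `(0,1)`-type theta occurrence in the POSITIVE orientation** (construction item; TRUE in nature by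
[Liu2021, Rem. D.5] for the endoscopic cohomological `π^∞ ≅ ω(λ, ε_a, χ)` of [Prop. D.4 (1)] — with `e♮ ∉ Φ_λ`, admissibility of `ε_a` for `Φ_λ ∋ ē♮` is
«negative on `Φ_λ ∖ {τ′₁}`, positive at `τ′₁ = e♮`», the `(0,1)` pattern — such `π^∞` existing on compact unitary Shimura curves by the non-vanishing of theta lifts
from `U(1)` [GelbartRogawski1991, §3], [Rogawski1990, §13.3]): there exist a CM field `L` with `4 ≤ [L:ℚ]`, `ι`, a form `H` with a rational frame `(g, t)`,
`0 < ι t` real, `ᵗ(c̄g)(t • H)g = diag dV` of signature `(1,1)` at `ι` and definite at every other complex place, a cone frame `𝔣` of `H` at `ι`, an automorphic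
measure, a label `λ` (conjugate symplectic of weight one) with `e♮ ∉ Φ_λ`, a line `⟨a⟩` and `χ ∈ Chi` with `ε_a` `λ`-admissible, an irreducible smooth `σ` with an
injective intertwiner into `ω(λ, ε_a, χ)_f ∘ (finAdelicCongr … g ht hg)⁻¹`, and a discrete `P` of `U(H)`, `(0,1)`-type at `ι` for `𝔣`, with finite component `σ`.
(Construction item, kept Summit-side on purpose: an EXISTENCE INSTANCE to be built in the tree, not a letter; references Liu 2021 App. D Rem. D.5 p. 131,
Prop. D.4 (1) p. 130–131, Def. 4.12; Gelbart–Rogawski 1991 §3; Rogawski 1990 §13.3.) -/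
def AntiholThetaOccurrence₂ : Prop :=
  ∃ (L : Type) (_ : Field L) (_ : NumberField L) (_ : IsCMField L) (ι : L →+* ℂ) (H : Matrix (Fin 2) (Fin 2) L)
    (dV : Fin 2 → L) (hdV : ∀ i, IsCMField.complexConj L (dV i) = dV i) (hdV0 : ∀ i, dV i ≠ 0)
    (t : L) (ht : t ≠ 0) (_ : 0 < (ι t).re) (_ : (ι t).im = 0) (g : GL (Fin 2) L)
    (hg : formCongr ((IsCMField.complexConj L : L ≃ₐ[↥(maximalRealSubfield L)] L) : L →+* L) g (t • H) = Matrix.diagonal dV)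
    (_ : ∃ T : GL (Fin 2) ℂ, formCongr (starRingEnd ℂ) T ((Matrix.diagonal dV).map ι) = Matrix.diagonal ![(1 : ℂ), -1])
    (_ : ∀ τ' : L →+* ℂ, InfinitePlace.mk τ' ≠ InfinitePlace.mk ι → ((Matrix.diagonal dV).map τ').PosDef)
    (_ : 4 ≤ Module.finrank ℚ L)
    (𝔣 : ConeFrame L H (cmPlace L ι))
    (μ : Measure (adelicGroupData (↥(maximalRealSubfield L)) L (IsCMField.complexConj L) 2 H).automorphicQuotient)
    (_ : (adelicGroupData (↥(maximalRealSubfield L)) L (IsCMField.complexConj L) 2 H).IsAutomorphicMeasure μ)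
    (n' : ℕ) (e₁ : Fin 2 × Fin 1 ≃ Fin n')
    (lam : Literature.NumberTheory.Automorphic.IdeleClassGroup L →ₜ* Circle) (hlam : IsConjugateSymplectic L lam) (_ : HasWeight L lam 1)
    (a : (↥(maximalRealSubfield L))ˣ) (χ : Chi (↥(maximalRealSubfield L)) L (IsCMField.complexConj L))
    (W : Type) (_ : AddCommGroup W) (_ : Module ℂ W)
    (σ : Representation ℂ (finAdelic (↥(maximalRealSubfield L)) L (IsCMField.complexConj L) 2 H) W)
    (_ : σ.IsIrreducible) (_ : σ.IsSmooth)
    (j : σ.IntertwiningMap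
        ((rhoVAtLine (↥(maximalRealSubfield L)) L (IsCMField.complexConj L) 2 e₁ (Matrix.diagonal dV)
            (complexConj_imagUnit L) (imagUnit_ne_zero L) (imagUnit_mul_self L) (realDiagonal_isSymm L dV hdV)
            (isUnit_det_realDiagonal L dV hdV hdV0) (realDiagonal_map L dV hdV).symm
            (fun a => isCompatible_chiSplittingLine L e₁ dV hdV hdV0 (toHeckeCharacter L lam)
              (isUnitary_toHeckeCharacter L lam) ((isOscillatorChar_toHeckeCharacter_iff lam).mpr hlam)
              (TW (↥(maximalRealSubfield L)) a) (isSymm_TW (↥(maximalRealSubfield L)) a)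
              (isUnit_det_TW (↥(maximalRealSubfield L)) a) (JW (↥(maximalRealSubfield L)) L a)
              (JW_eq (↥(maximalRealSubfield L)) L a)) a χ).comp
          (finAdelicCongr (↥(maximalRealSubfield L)) L (IsCMField.complexConj L) g ht hg).symm.toMonoidHom))
    (_ : Function.Injective j)
    (P : DiscreteAutomorphicRep (adelicGroupData (↥(maximalRealSubfield L)) L (IsCMField.complexConj L) 2 H) μ),
    P.IsAntiholCotangentAt₂ (IsCMField.complexConj_ne_one L) (UnitaryGroup.complexConj_smul_infinitePlace L) (cmPlace L ι) 𝔣 ∧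
      P.HasFinComponent σ ∧
      (∃ e : L, IsAdmissibleElement L hlam.cmType.1 e ∧
          epsOf (↥(maximalRealSubfield L)) (imagUnitSq L) L (2 * imagUnit L)⁻¹ e = locF (↥(maximalRealSubfield L)) (imagUnitSq L) a) ∧
      (cmPlace L ι).1.embedding ∉ hlam.cmType.1

/-! ## §2 The negative lemma -/

/-- **LETTER #74 AS TYPED IS FALSE modulo the cone-flip transport and one honest antiholomorphic theta occurrence.**  Flip the `(0,1)` occurrence
`(H, t, 𝔣, P)` of `AntiholThetaOccurrence₂` (orientation `0 < ι t`) along `ConeFlipTransport₂` to a `(1,0)` occurrence on the datum of `−H` in the frame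
`(g, −t)` — `(−t) • (−H) = t • H`, so the signature, definiteness and admissibility clauses are untouched, and #74 carries NO orientation binder to refuse
`ι(−t) < 0` — and apply #74 there: `e♮ ∈ Φ_λ`, against `e♮ ∉ Φ_λ`.  (The re-letter #74R ★ `curveThetaHodgeTypeNecessity_hol_pos` is immune: `hτt`.)
[cite: Liu2021, App. D Rem. D.5 (p. 131); Prop. D.4 (1)] [cite: BorelWallach2000, VII 2.10 and 3.6] -/
theorem curveThetaHodgeTypeNecessity_hol_false_of_coneFlipTransport₂ (hT : ConeFlipTransport₂) (hE : AntiholThetaOccurrence₂) :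
    ¬ curveThetaHodgeTypeNecessity_hol := by
  intro h74
  obtain ⟨L, _, _, _, ι, H, dV, hdV, hdV0, t, ht, -, -, g, hg, hsig, hpos, h4, 𝔣, μ, _, n', e₁, lam, hlam, h1, a, χ, W, _, _, σ,
    hirr, hsm, j, hj, P, hP, hfin, hadm, hnot⟩ := hE
  have ht' : -t ≠ 0 := neg_ne_zero.mpr ht
  have hg' : formCongr ((IsCMField.complexConj L : L ≃ₐ[↥(maximalRealSubfield L)] L) : L →+* L) g ((-t) • (-H)) = Matrix.diagonal dV := by
    rw [neg_smul_neg]; exact hg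
  obtain ⟨𝔣', μ', _, W', _, _, σ', hirr', hsm', j', hj', P', hP', hfin'⟩ :=
    hT L ι H dV hdV hdV0 t ht g hg 𝔣 μ e₁ lam hlam a χ W σ hirr hsm j hj P hP hfin ht' hg'
  exact hnot (h74 L ι (-H) dV hdV hdV0 (-t) ht' g hg' hsig hpos h4 𝔣' μ' e₁ lam hlam h1 a χ W' σ' hirr' hsm' j' hj' P' hP' hfin' hadm)

end Summit.HodgeConjecture.HodgeConjecture.Cruxes.HLiu418.F0LD2CurveThetaConeFlipNegative

end
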